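import Literature.NumberTheory.GaloisRepresentations.AbsGaloisOuterConj
import Mathlib.NumberTheory.Cyclotomic.PrimitiveRoots
import HarnessLib

/-!
# `res(Γ_{E(ζ_n)}) = res⁻¹(res Γ_{K(ζ_n)})`: the subgroup of `Γ_E` fixing the `n`-th roots of unity

Topic `Literature/NumberTheory/GaloisRepresentations`.  Theorem-only file (no named fact, no new
notion).  For an extension `E/K` of fields of characteristic `0` and `n ≥ 1`, an element
`σ ∈ Γ_E` lies in the image of `Γ_{E(ζ_n)} → Γ_E` (`absGaloisRestrict E (CyclotomicField n E)`)
iff its restriction `res_{K,E}(σ) ∈ Γ_K` lies in the image of `Γ_{K(ζ_n)} → Γ_K`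
(`mem_range_absGaloisRestrict_cyclotomicField_iff`): both say that `σ` fixes the (equivalently:
one primitive) `n`-th roots of unity of `Ē`, the copy of `K(ζ_n)` inside `K̄` being carried into
`Ē` by the chosen embedding `K̄ → Ē` along which `res_{K,E}` is defined
(`absGaloisRestrict_apply_smul`).  This is hypothesis `hM` ("`M = E·L` presents `Γ_{EL}`") of the
Mackey criteria `MackeyInducedIrreducible` / `InducedResiduallyAbsIrreducible` for `L = K(ζ_p)`,
`M = E(ζ_p)` — the shape of "`(Ind_E^K W)|_{K(ζ_p)}`" in the potential-automorphy theorems.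

* `forall_smul_absEmbedding_eq_iff_of_isPrimitiveRoot` — `g ∈ Γ_F` fixes the copy `e(M)` of a
  cyclotomic extension `M = F(ζ)` pointwise iff it fixes `e(ζ)` (`adjoin_primitive_root_eq_top`);
* `smul_eq_self_iff_of_isPrimitiveRoot` — fixing one primitive `n`-th root of unity of `F̄` is
  fixing any other (they are powers of each other).

## References

* J. Neukirch, *Algebraic Number Theory* (1999), Ch. IV §1 (restriction maps between absolute
  Galois groups). [NeukirchANT1999]
* J. S. Milne, *Fields and Galois Theory* (2022), Ch. 7. [MilneFT2022]
-/

noncomputable section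

open Field

namespace Literature.NumberTheory.GaloisRepresentations

/-- **An element of `Γ_F` fixes the copy of a cyclotomic extension `M = F(ζ)` inside `F̄`
pointwise iff it fixes the image of `ζ`** (`M` is generated by `ζ` over `F`,
`IsCyclotomicExtension.adjoin_primitive_root_eq_top`; `Γ_F` acts by `F`-algebra maps).
[folklore] -/
theorem forall_smul_absEmbedding_eq_iff_of_isPrimitiveRoot (F M : Type*) [Field F] [Field M]
    [Algebra F M] [Algebra.IsAlgebraic F M] {n : ℕ} [NeZero n] [IsCyclotomicExtension {n} F M]
    {ζ : M} (hζ : IsPrimitiveRoot ζ n) (g : absoluteGaloisGroup F) :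
    (∀ x : M, g • absEmbedding F M x = absEmbedding F M x) ↔
      g • absEmbedding F M ζ = absEmbedding F M ζ := by
  refine ⟨fun h => h ζ, fun h x => ?_⟩
  have hx : x ∈ Algebra.adjoin F ({ζ} : Set M) := by
    rw [IsCyclotomicExtension.adjoin_primitive_root_eq_top hζ]
    exact Algebra.mem_top
  induction hx using Algebra.adjoin_induction with
  | mem y hy => rw [Set.mem_singleton_iff.1 hy]; exact h
  | algebraMap a => rw [AlgHom.commutes, absoluteGaloisGroup.smul_def, AlgEquiv.commutes]
  | add y z _ _ hy hz => rw [map_add, smul_add, hy, hz]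
  | mul y z _ _ hy hz => rw [map_mul, smul_mul', hy, hz]

/-- **Fixing one primitive `n`-th root of unity of `F̄` is fixing any other**: two primitive
`n`-th roots of unity in the field `F̄` are powers of each other. [folklore] -/
theorem smul_eq_self_iff_of_isPrimitiveRoot {F : Type*} [Field F] {n : ℕ} [NeZero n]
    {μ μ' : AlgebraicClosure F} (hμ : IsPrimitiveRoot μ n) (hμ' : IsPrimitiveRoot μ' n)
    (g : absoluteGaloisGroup F) : g • μ = μ ↔ g • μ' = μ' := by
  obtain ⟨i, -, rfl⟩ := hμ.eq_pow_of_pow_eq_one hμ'.pow_eq_one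
  obtain ⟨j, -, hj⟩ := hμ'.eq_pow_of_pow_eq_one hμ.pow_eq_one
  constructor
  · intro h
    rw [smul_pow', h]
  · intro h
    rw [← hj, smul_pow', h]

/-- **`σ ∈ Γ_E` comes from `Γ_{E(ζ_n)}` iff `res_{K,E}(σ) ∈ Γ_K` comes from `Γ_{K(ζ_n)}`**
(`E/K` fields of characteristic `0`, `n ≥ 1`, Mathlib `CyclotomicField n`): both conditions say
that `σ` fixes the primitive `n`-th roots of unity of `Ē` — for the second, transport the copy of
`K(ζ_n)` in `K̄` to `Ē` along the chosen embedding (`absGaloisRestrict_apply_smul`).  Hypothesis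
`hM` of `FramedGaloisRep.isAbsolutelyIrreducible_restrictField_induce_of_finrank_eq_two` and
`isResiduallyAbsIrreducible_restrictField_induce_of_finrank_eq_two` for `L = K(ζ_n)`, `M = E(ζ_n)`.
[cite: NeukirchANT1999, Ch. IV §1] -/
theorem mem_range_absGaloisRestrict_cyclotomicField_iff (K E : Type*) [Field K] [Field E]
    [Algebra K E] [CharZero K] [CharZero E] (n : ℕ) [NeZero n] (σ : absoluteGaloisGroup E) :
    σ ∈ (absGaloisRestrict E (CyclotomicField n E)).range ↔
      absGaloisRestrict K E σ ∈ (absGaloisRestrict K (CyclotomicField n K)).range := by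
  haveI : FiniteDimensional E (CyclotomicField n E) :=
    IsCyclotomicExtension.finiteDimensional {n} E (CyclotomicField n E)
  haveI : FiniteDimensional K (CyclotomicField n K) :=
    IsCyclotomicExtension.finiteDimensional {n} K (CyclotomicField n K)
  haveI : Algebra.IsAlgebraic E (CyclotomicField n E) := Algebra.IsAlgebraic.of_finite E _
  haveI : Algebra.IsAlgebraic K (CyclotomicField n K) := Algebra.IsAlgebraic.of_finite K _
  -- primitive roots in the two cyclotomic fields and their images in `Ē`
  have hζE := IsCyclotomicExtension.zeta_spec n E (CyclotomicField n E)
  have hζK := IsCyclotomicExtension.zeta_spec n K (CyclotomicField n K)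
  set μE : AlgebraicClosure E :=
    absEmbedding E (CyclotomicField n E) (IsCyclotomicExtension.zeta n E (CyclotomicField n E))
    with hμE
  set μK' : AlgebraicClosure K :=
    absEmbedding K (CyclotomicField n K) (IsCyclotomicExtension.zeta n K (CyclotomicField n K))
    with hμK'
  have hμEp : IsPrimitiveRoot μE n :=
    hζE.map_of_injective (absEmbedding E (CyclotomicField n E)).toRingHom.injective
  have hμK'p : IsPrimitiveRoot μK' n :=
    hζK.map_of_injective (absEmbedding K (CyclotomicField n K)).toRingHom.injective
  have hμKp : IsPrimitiveRoot (absClosureEmbedding K E μK') n :=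
    hμK'p.map_of_injective (absClosureEmbedding K E).toRingHom.injective
  rw [mem_range_absGaloisRestrict_iff_smul_absEmbedding,
    mem_range_absGaloisRestrict_iff_smul_absEmbedding,
    forall_smul_absEmbedding_eq_iff_of_isPrimitiveRoot E (CyclotomicField n E) hζE,
    forall_smul_absEmbedding_eq_iff_of_isPrimitiveRoot K (CyclotomicField n K) hζK,
    smul_eq_self_iff_of_isPrimitiveRoot hμEp hμKp σ,
    ← (absClosureEmbedding K E).toRingHom.injective.eq_iff]
  change _ ↔ absClosureEmbedding K E (absGaloisRestrict K E σ • μK') = absClosureEmbedding K E μK'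
  rw [absGaloisRestrict_apply_smul]

end Literature.NumberTheory.GaloisRepresentations

end
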